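/-
Copyright: cell `pub-balaban-gaps` (G2), seat ne6 (row NE7b), `prover-pub-balaban-gaps-ne6-g18-0`. Project licence.
-/
import Summits.QuantumFields.BalabanUV.T4Continuum.Spine.NE7b.CompactFibreHalvedActionSUN
import Summits.QuantumFields.BalabanUV.T4Continuum.Spine.NE7b.CompactFibreProfileVolumeSUN
import Summits.QuantumFields.BalabanUV.T4Continuum.Spine.NE7b.CompactFibrePlaquetteMassSUNTangentFloor
import Mathlib.MeasureTheory.Integral.Prod
import Mathlib.Analysis.Calculus.ParametricIntegral
import Mathlib.Analysis.Convex.Deriv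
import Mathlib.Analysis.SpecialFunctions.Log.Deriv

/-!
# THE TILTED MEAN ACTION OF THE `SU(N)` PLAQUETTE IS NON-INCREASING IN THE COUPLING AND AT MOST `N`, AND THE ONE-PLAQUETTE FREE ENERGY
# `F_N(β) = −log ∫ e^{−β·Re tr(1−V)} dHaar_{SU(N)}(V)` IS `C¹`, CONCAVE AND NON-DECREASING WITH `F_N′ = ⟨Re tr(1−V)⟩_β`, FOR EVERY `N`
# — by a weighted Chebyshev (antivarying) integral inequality and differentiation under the Haar integral; no chart, no Weyl (row NE7b, node U5c; MODEL, [folklore]; census V50)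

Cell `pub-balaban-gaps` (G2 spine census) for the `pub-balaban` T⁴ crux NE7b (`T4WeightBudget.RelWeightBound`; NOT PRINTED, NOT PROVED).  Crux-route work under
`Spine/NE7b/`; imports this lineage's V38 `CompactFibreHalvedActionSUN` (measurability, `Re tr(1−V) ≤ 2N`), V35 `CompactFibreProfileVolumeSUN` (`0 ≤ Re tr(1−V)`), V46
`CompactFibrePlaquetteMassSUNTangentFloor` (`∫ Re tr(1−V) dHaar_{SU(N)} = N`, `N ≥ 2`) + Mathlib (`integral_prod_mul`, `hasDerivAt_integral_of_dominated_loc_of_deriv_le`,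
`AntitoneOn.concaveOn_of_deriv`); no `def`, zero `sorry`, nothing of Bałaban's asserted.  (The tree's `Literature…AntitheticVariates.measureReal_mul_integral_mul_le_…_of_antivary`
is the UNWEIGHTED Chebyshev inequality; §1 here is the weighted form needed for the tilted states, proved directly on the product measure.)

THE LOCATED QUESTION (census V50).  V46: at `β = 0` the reference state's mean action is `⟨s⟩₀ = N` (`s = Re tr(1−V)`); V44 §8 (N = 2): `β⟨s⟩_β < 3∕2` at every `β`; V49∕J4
(this gen): `β⟨s⟩_β → (N²−1)∕2` as `β → ∞` for every `N`.  QUESTION: what is the SHAPE in between, for every `N` — is `β ↦ ⟨s⟩_β` monotone, is `⟨s⟩_β ≤ N` at every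
coupling, is the free energy `F_N = −log Z_N` concave with derivative the tilted mean (so that `Z_N` is log-convex), all WITHOUT a chart of `SU(N)`?

ANSWER ([folklore]):
* §1 ABSTRACT — **`integral_mul_mul_le_of_antivary_weight`**: on a finite measure space, for real `f, g, w` with `(f x − f y)(g x − g y) ≤ 0` for all `x, y` (antivarying) and
  `w ≥ 0` (all products integrable): `(∫ f g w)(∫ w) ≤ (∫ f w)(∫ g w)` — Chebyshev's integral inequality with a weight (the double integral of
  `(f x − f y)(g x − g y) w x w y ≤ 0` expanded by `integral_prod_mul`; no Fubini beyond that).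
* §2 `SU(N)`, EVERY `N` — `integrable_of_abs_le` (bookkeeping), **`meanAction_cross_le`** (`0 ≤ β₁ ≤ β₂`: `(∫ s e^{−β₂s})(∫ e^{−β₁s}) ≤ (∫ s e^{−β₁s})(∫ e^{−β₂s})`, §1 with
  `f = s`, `g = e^{−(β₂−β₁)s}`, `w = e^{−β₁s}`), **`meanAction_antitoneOn`**: `β ↦ ⟨s⟩_β = ∫ s e^{−βs} dHaar ∕ ∫ e^{−βs} dHaar` is ANTITONE on `[0, ∞)`;
  `meanAction_zero` (`⟨s⟩₀ = N`, `N ≥ 2`, V46), **`meanAction_le`**: `⟨s⟩_β ≤ N` for every `β ≥ 0` (`N ≥ 2`); `meanAction_nonneg`; `plaquetteMass_SUN_pos_real`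
  (`Z_N(β) > 0` for every REAL `β`).
* §3 THE FREE ENERGY — **`hasDerivAt_plaquetteMass_SUN`**: `Z_N′(β) = −∫ s e^{−βs} dHaar` at EVERY real `β` (dominated differentiation, `|s e^{−βs}| ≤ 2N·e^{2N(|β₀|+1)}` on
  `ball β₀ 1`); **`hasDerivAt_freeEnergy_SUN`** (every real `β`): `F_N′(β) = ⟨s⟩_β`; **`freeEnergy_SUN_concaveOn`**: `F_N` is CONCAVE on `[0, ∞)` (`F′ = ⟨s⟩` antitone,
  `AntitoneOn.concaveOn_of_deriv`); **`freeEnergy_SUN_monotoneOn`**: `F_N` is non-decreasing on `[0, ∞)` (`F′ ≥ 0`); **`log_plaquetteMass_SUN_convexOn`**: `log Z_N` is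
  CONVEX on `[0, ∞)` (`Z_N` log-convex in the coupling).
  With V49∕J4: `F_N(β) = ((N²−1)∕2)·log β + c₁ + o(1)` and `β·F_N′(β) → (N²−1)∕2`; with V46: `F_N(β) ≤ Nβ`, `F_N′ ≤ N`.

HONEST REMARKS.  (i) MODEL ∕ [folklore]: ONE plaquette variable under Haar; nothing of the interacting measure.  (ii) No strict monotonicity ∕ strict concavity claimed
(they hold — the variance of `s` in a tilted state is positive — but are not needed); nothing for `β < 0` beyond differentiability.  (iii) (A3) ∕ (A1c) NOT asserted;
NC-NE7b-α UNRULED.  BY-NAME EFFECT ON THE WALL: NONE.  NE7b NOT PRINTED ∕ NOT PROVED; spine PROVED 0∕9; rung (B)+1 on ONE finite T⁴ — NOT infinite volume, NOT the mass gap,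
NOT Clay.
HONEST DEPENDENCY: continuum YM on T⁴ ⇐ BetaPertH ∧ nine spine estimates (0/9 proved); BetaPertH ⇐ (D1) ∧ (D4) ∧ CAP+tail;
G-an2-4 gates asym, D1 and NE2/3/4.  This file changes none of it.
-/

set_option autoImplicit false

noncomputable section

open MeasureTheory Real Set Filter Topology Metric
open scoped Matrix.Norms.Frobenius
open Literature.MathematicalPhysics.QuantumFieldTheory (haarProbability)
open Summit.QuantumFields.BalabanUV.T4Continuum.NE7b.CompactFibreHalvedActionSUN (measurable_re_trace_one_sub re_trace_one_sub_le_two_mul)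
open Summit.QuantumFields.BalabanUV.T4Continuum.NE7b.CompactFibreProfileVolumeSUN (re_trace_one_sub_nonneg)
open Summit.QuantumFields.BalabanUV.T4Continuum.NE7b.CompactFibrePlaquetteMassSUNTangentFloor (integral_re_trace_one_sub_haar_SUN)

namespace Summit.QuantumFields.BalabanUV.T4Continuum.NE7b.CompactFibreMeanActionSUNMonotone

/-! ## §1 Chebyshev's integral inequality with a weight -/

section Chebyshev

variable {X : Type*} [MeasurableSpace X] (μ : Measure X) [IsFiniteMeasure μ]

/-- **CHEBYSHEV's (ANTIVARYING) INTEGRAL INEQUALITY WITH A WEIGHT.**  On a finite measure space, if `(f x − f y)·(g x − g y) ≤ 0` for all `x, y` and `w ≥ 0`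
(the four products integrable), then `(∫ f·g·w dμ)·(∫ w dμ) ≤ (∫ f·w dμ)·(∫ g·w dμ)` — the double integral of `(f x − f y)(g x − g y)·w x·w y ≤ 0` over `μ ⊗ μ`,
expanded into four product integrals. [folklore] -/
theorem integral_mul_mul_le_of_antivary_weight {f g w : X → ℝ} (hanti : ∀ x y, (f x - f y) * (g x - g y) ≤ 0) (hw : ∀ x, 0 ≤ w x)
    (hfgw : Integrable (fun x => f x * g x * w x) μ) (hfw : Integrable (fun x => f x * w x) μ) (hgw : Integrable (fun x => g x * w x) μ)
    (hwi : Integrable w μ) :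
    (∫ x, f x * g x * w x ∂μ) * (∫ x, w x ∂μ) ≤ (∫ x, f x * w x ∂μ) * (∫ x, g x * w x ∂μ) := by
  -- the four product integrands on `X × X`
  have i1 : Integrable (fun z : X × X => (f z.1 * g z.1 * w z.1) * w z.2) (μ.prod μ) := hfgw.mul_prod hwi
  have i2 : Integrable (fun z : X × X => (f z.1 * w z.1) * (g z.2 * w z.2)) (μ.prod μ) := hfw.mul_prod hgw
  have i3 : Integrable (fun z : X × X => (g z.1 * w z.1) * (f z.2 * w z.2)) (μ.prod μ) := hgw.mul_prod hfw
  have i4 : Integrable (fun z : X × X => w z.1 * (f z.2 * g z.2 * w z.2)) (μ.prod μ) := hwi.mul_prod hfgw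
  -- the symmetric integrand is pointwise `≤ 0`
  have hH : ∫ z : X × X, ((f z.1 * g z.1 * w z.1) * w z.2 - (f z.1 * w z.1) * (g z.2 * w z.2) - (g z.1 * w z.1) * (f z.2 * w z.2)
      + w z.1 * (f z.2 * g z.2 * w z.2)) ∂(μ.prod μ) ≤ 0 := by
    refine integral_nonpos fun z => ?_
    have hz : (f z.1 * g z.1 * w z.1) * w z.2 - (f z.1 * w z.1) * (g z.2 * w z.2) - (g z.1 * w z.1) * (f z.2 * w z.2) + w z.1 * (f z.2 * g z.2 * w z.2)
        = ((f z.1 - f z.2) * (g z.1 - g z.2)) * (w z.1 * w z.2) := by ring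
    rw [hz]
    exact mul_nonpos_iff.2 (Or.inr ⟨hanti _ _, mul_nonneg (hw _) (hw _)⟩)
  have i12 : Integrable (fun z : X × X => (f z.1 * g z.1 * w z.1) * w z.2 - (f z.1 * w z.1) * (g z.2 * w z.2)) (μ.prod μ) := i1.sub i2
  have i123 : Integrable (fun z : X × X => (f z.1 * g z.1 * w z.1) * w z.2 - (f z.1 * w z.1) * (g z.2 * w z.2) - (g z.1 * w z.1) * (f z.2 * w z.2)) (μ.prod μ) :=
    i12.sub i3
  have e1 : ∫ z : X × X, (f z.1 * g z.1 * w z.1) * w z.2 ∂(μ.prod μ) = (∫ x, f x * g x * w x ∂μ) * ∫ y, w y ∂μ :=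
    integral_prod_mul (μ := μ) (ν := μ) (fun x => f x * g x * w x) w
  have e2 : ∫ z : X × X, (f z.1 * w z.1) * (g z.2 * w z.2) ∂(μ.prod μ) = (∫ x, f x * w x ∂μ) * ∫ y, g y * w y ∂μ :=
    integral_prod_mul (μ := μ) (ν := μ) (fun x => f x * w x) (fun y => g y * w y)
  have e3 : ∫ z : X × X, (g z.1 * w z.1) * (f z.2 * w z.2) ∂(μ.prod μ) = (∫ x, g x * w x ∂μ) * ∫ y, f y * w y ∂μ :=
    integral_prod_mul (μ := μ) (ν := μ) (fun x => g x * w x) (fun y => f y * w y)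
  have e4 : ∫ z : X × X, w z.1 * (f z.2 * g z.2 * w z.2) ∂(μ.prod μ) = (∫ x, w x ∂μ) * ∫ y, f y * g y * w y ∂μ :=
    integral_prod_mul (μ := μ) (ν := μ) w (fun y => f y * g y * w y)
  rw [integral_add i123 i4, integral_sub i12 i3, integral_sub i1 i2, e1, e2, e3, e4] at hH
  nlinarith [hH]

end Chebyshev

/-! ## §2 `SU(N)`, every `N`: the tilted mean action is antitone in the coupling and at most `N` -/

section SUN

variable {N : ℕ}

/-- Bookkeeping: a measurable real function on `SU(N)` bounded in absolute value is integrable against the Haar probability measure. [folklore] -/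
theorem integrable_of_abs_le {φ : Matrix.specialUnitaryGroup (Fin N) ℂ → ℝ} (hφ : Measurable φ) (K : ℝ) (hK : ∀ V, |φ V| ≤ K) :
    Integrable φ (haarProbability (Matrix.specialUnitaryGroup (Fin N) ℂ)) :=
  Integrable.of_bound hφ.aestronglyMeasurable K (ae_of_all _ fun V => by rw [Real.norm_eq_abs]; exact hK V)

/-- For `γ ≥ 0`: `0 < e^{−γ·Re tr(1−V)} ≤ 1` and `0 ≤ Re tr(1−V) ≤ 2N` give the bounds used below. -/
theorem exp_neg_mul_traceDeficit_le_one {γ : ℝ} (hγ : 0 ≤ γ) (V : Matrix.specialUnitaryGroup (Fin N) ℂ) :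
    Real.exp (-(γ * (Matrix.trace (1 - (V : Matrix (Fin N) (Fin N) ℂ))).re)) ≤ 1 := by
  rw [Real.exp_le_one_iff, neg_nonpos]; exact mul_nonneg hγ (re_trace_one_sub_nonneg V)

/-- **THE CROSS INEQUALITY**: for `0 ≤ β₁ ≤ β₂`,
`(∫ s·e^{−β₂s} dHaar_{SU(N)})·(∫ e^{−β₁s} dHaar_{SU(N)}) ≤ (∫ s·e^{−β₁s} dHaar_{SU(N)})·(∫ e^{−β₂s} dHaar_{SU(N)})`, `s = Re tr(1−V)` (§1 with `f = s`, `g = e^{−(β₂−β₁)s}`,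
`w = e^{−β₁s}`). [folklore] -/
theorem meanAction_cross_le {β₁ β₂ : ℝ} (h₁ : 0 ≤ β₁) (h₁₂ : β₁ ≤ β₂) :
    (∫ V, (Matrix.trace (1 - (V : Matrix (Fin N) (Fin N) ℂ))).re * Real.exp (-(β₂ * (Matrix.trace (1 - (V : Matrix (Fin N) (Fin N) ℂ))).re))
        ∂(haarProbability (Matrix.specialUnitaryGroup (Fin N) ℂ))) *
      (∫ V, Real.exp (-(β₁ * (Matrix.trace (1 - (V : Matrix (Fin N) (Fin N) ℂ))).re)) ∂(haarProbability (Matrix.specialUnitaryGroup (Fin N) ℂ)))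
    ≤ (∫ V, (Matrix.trace (1 - (V : Matrix (Fin N) (Fin N) ℂ))).re * Real.exp (-(β₁ * (Matrix.trace (1 - (V : Matrix (Fin N) (Fin N) ℂ))).re))
        ∂(haarProbability (Matrix.specialUnitaryGroup (Fin N) ℂ))) *
      (∫ V, Real.exp (-(β₂ * (Matrix.trace (1 - (V : Matrix (Fin N) (Fin N) ℂ))).re)) ∂(haarProbability (Matrix.specialUnitaryGroup (Fin N) ℂ))) := by
  set μ := haarProbability (Matrix.specialUnitaryGroup (Fin N) ℂ) with hμ
  set s : Matrix.specialUnitaryGroup (Fin N) ℂ → ℝ := fun V => (Matrix.trace (1 - (V : Matrix (Fin N) (Fin N) ℂ))).re with hs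
  have hsm : Measurable s := measurable_re_trace_one_sub
  have hs0 : ∀ V, 0 ≤ s V := fun V => re_trace_one_sub_nonneg V
  have hs2 : ∀ V, s V ≤ 2 * N := fun V => re_trace_one_sub_le_two_mul V
  set c : ℝ := β₂ - β₁ with hc
  have hc0 : 0 ≤ c := by rw [hc]; linarith
  -- `f = s`, `g = e^{−c s}`, `w = e^{−β₁ s}`
  set g : Matrix.specialUnitaryGroup (Fin N) ℂ → ℝ := fun V => Real.exp (-(c * s V)) with hg
  set w : Matrix.specialUnitaryGroup (Fin N) ℂ → ℝ := fun V => Real.exp (-(β₁ * s V)) with hw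
  have hgm : Measurable g := Real.measurable_exp.comp ((hsm.const_mul c).neg)
  have hwm : Measurable w := Real.measurable_exp.comp ((hsm.const_mul β₁).neg)
  have hg1 : ∀ V, g V ≤ 1 := fun V => exp_neg_mul_traceDeficit_le_one hc0 V
  have hw1 : ∀ V, w V ≤ 1 := fun V => exp_neg_mul_traceDeficit_le_one h₁ V
  have hg0 : ∀ V, 0 < g V := fun V => Real.exp_pos _
  have hw0 : ∀ V, 0 < w V := fun V => Real.exp_pos _
  -- antivarying: `s` up, `e^{−cs}` down
  have hanti : ∀ x y : Matrix.specialUnitaryGroup (Fin N) ℂ, (s x - s y) * (g x - g y) ≤ 0 := fun x y => by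
    rcases le_total (s x) (s y) with hxy | hxy
    · have : g y ≤ g x := Real.exp_le_exp.2 (by nlinarith)
      exact mul_nonpos_iff.2 (Or.inr ⟨by linarith, by linarith⟩)
    · have : g x ≤ g y := Real.exp_le_exp.2 (by nlinarith)
      exact mul_nonpos_iff.2 (Or.inl ⟨by linarith, by linarith⟩)
  -- integrability (all bounded by `2N` or `1`)
  have hfgw : Integrable (fun V => s V * g V * w V) μ :=
    integrable_of_abs_le ((hsm.mul hgm).mul hwm) (2 * N) fun V => by
      rw [abs_mul, abs_mul, abs_of_nonneg (hs0 V), abs_of_pos (hg0 V), abs_of_pos (hw0 V)]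
      calc s V * g V * w V ≤ 2 * N * 1 * 1 := by gcongr <;> linarith [hs0 V, hs2 V, hg1 V, hw1 V, (hg0 V).le, (hw0 V).le]
        _ = 2 * N := by ring
  have hfw : Integrable (fun V => s V * w V) μ :=
    integrable_of_abs_le (hsm.mul hwm) (2 * N) fun V => by
      rw [abs_mul, abs_of_nonneg (hs0 V), abs_of_pos (hw0 V)]
      calc s V * w V ≤ 2 * N * 1 := by gcongr <;> linarith [hs0 V, hs2 V, hw1 V]
        _ = 2 * N := by ring
  have hgw : Integrable (fun V => g V * w V) μ :=
    integrable_of_abs_le (hgm.mul hwm) 1 fun V => by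
      rw [abs_mul, abs_of_pos (hg0 V), abs_of_pos (hw0 V)]
      calc g V * w V ≤ 1 * 1 := by gcongr <;> linarith [hg1 V, hw1 V, (hg0 V).le]
        _ = 1 := by ring
  have hwi : Integrable w μ := integrable_of_abs_le hwm 1 fun V => by rw [abs_of_pos (hw0 V)]; exact hw1 V
  have hmain := integral_mul_mul_le_of_antivary_weight μ hanti (fun V => (hw0 V).le) hfgw hfw hgw hwi
  -- identify the four integrals
  have e1 : ∀ V, s V * g V * w V = s V * Real.exp (-(β₂ * s V)) := fun V => by
    simp only [hg, hw, hc]; rw [mul_assoc, ← Real.exp_add]; congr 1; congr 1; ring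
  have e2 : ∀ V, g V * w V = Real.exp (-(β₂ * s V)) := fun V => by
    simp only [hg, hw, hc]; rw [← Real.exp_add]; congr 1; ring
  simp_rw [e1, e2] at hmain
  simpa only [hs, hw] using hmain

/-- **`Z_N(β) > 0` FOR EVERY REAL `β`** (integrand positive and bounded by `e^{2N|β|}` against a probability measure; V48's `plaquetteMass_SUN_pos` is the case `β ≥ 0`
with the bound `1`). [folklore] -/
theorem plaquetteMass_SUN_pos_real (β : ℝ) :
    0 < ∫ V, Real.exp (-(β * (Matrix.trace (1 - (V : Matrix (Fin N) (Fin N) ℂ))).re)) ∂(haarProbability (Matrix.specialUnitaryGroup (Fin N) ℂ)) := by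
  have hint : Integrable (fun V : Matrix.specialUnitaryGroup (Fin N) ℂ => Real.exp (-(β * (Matrix.trace (1 - (V : Matrix (Fin N) (Fin N) ℂ))).re)))
      (haarProbability (Matrix.specialUnitaryGroup (Fin N) ℂ)) :=
    integrable_of_abs_le (Real.measurable_exp.comp ((measurable_re_trace_one_sub.const_mul β).neg)) (Real.exp (|β| * (2 * N))) fun V => by
      rw [abs_of_pos (Real.exp_pos _), Real.exp_le_exp]
      have h0 := re_trace_one_sub_nonneg V
      have h2 := re_trace_one_sub_le_two_mul V
      have h1 : -(β * (Matrix.trace (1 - (V : Matrix (Fin N) (Fin N) ℂ))).re) ≤ |β| * (Matrix.trace (1 - (V : Matrix (Fin N) (Fin N) ℂ))).re := by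
        have := mul_le_mul_of_nonneg_right (neg_abs_le β) h0
        linarith
      have h3 : |β| * (Matrix.trace (1 - (V : Matrix (Fin N) (Fin N) ℂ))).re ≤ |β| * (2 * N) := mul_le_mul_of_nonneg_left h2 (abs_nonneg β)
      linarith
  exact integral_exp_pos hint

/-- **THE TILTED MEAN ACTION IS ANTITONE IN THE COUPLING, EVERY `N`**: `β ↦ ⟨s⟩_β = ∫ s·e^{−βs} dHaar_{SU(N)} ∕ ∫ e^{−βs} dHaar_{SU(N)}` (`s = Re tr(1−V)`) is
non-increasing on `[0, ∞)`. [folklore] -/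
theorem meanAction_antitoneOn :
    AntitoneOn (fun β : ℝ =>
        (∫ V, (Matrix.trace (1 - (V : Matrix (Fin N) (Fin N) ℂ))).re * Real.exp (-(β * (Matrix.trace (1 - (V : Matrix (Fin N) (Fin N) ℂ))).re))
            ∂(haarProbability (Matrix.specialUnitaryGroup (Fin N) ℂ))) /
          ∫ V, Real.exp (-(β * (Matrix.trace (1 - (V : Matrix (Fin N) (Fin N) ℂ))).re)) ∂(haarProbability (Matrix.specialUnitaryGroup (Fin N) ℂ)))
      (Set.Ici 0) := by
  intro β₁ h₁ β₂ _ h₁₂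
  have hβ₁ : 0 ≤ β₁ := h₁
  have hZ₁ := plaquetteMass_SUN_pos_real (N := N) β₁
  have hZ₂ := plaquetteMass_SUN_pos_real (N := N) β₂
  rw [div_le_div_iff₀ hZ₂ hZ₁]
  exact meanAction_cross_le hβ₁ h₁₂

/-- **`⟨s⟩₀ = N`** (`N ≥ 2`; V46's mean action under Haar, `Z_N(0) = 1`). [folklore] -/
theorem meanAction_zero (hN : 2 ≤ N) :
    (∫ V, (Matrix.trace (1 - (V : Matrix (Fin N) (Fin N) ℂ))).re * Real.exp (-((0 : ℝ) * (Matrix.trace (1 - (V : Matrix (Fin N) (Fin N) ℂ))).re))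
        ∂(haarProbability (Matrix.specialUnitaryGroup (Fin N) ℂ))) /
      ∫ V, Real.exp (-((0 : ℝ) * (Matrix.trace (1 - (V : Matrix (Fin N) (Fin N) ℂ))).re)) ∂(haarProbability (Matrix.specialUnitaryGroup (Fin N) ℂ)) = N := by
  simp only [zero_mul, neg_zero, Real.exp_zero, mul_one, integral_const, probReal_univ, one_smul, div_one]
  exact integral_re_trace_one_sub_haar_SUN hN

/-- **THE TILTED MEAN ACTION NEVER EXCEEDS THE REFERENCE MEAN**: `⟨s⟩_β ≤ N` for every `β ≥ 0` (`N ≥ 2`; antitone from `⟨s⟩₀ = N`). [folklore] -/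
theorem meanAction_le (hN : 2 ≤ N) {β : ℝ} (hβ : 0 ≤ β) :
    (∫ V, (Matrix.trace (1 - (V : Matrix (Fin N) (Fin N) ℂ))).re * Real.exp (-(β * (Matrix.trace (1 - (V : Matrix (Fin N) (Fin N) ℂ))).re))
        ∂(haarProbability (Matrix.specialUnitaryGroup (Fin N) ℂ))) /
      ∫ V, Real.exp (-(β * (Matrix.trace (1 - (V : Matrix (Fin N) (Fin N) ℂ))).re)) ∂(haarProbability (Matrix.specialUnitaryGroup (Fin N) ℂ)) ≤ N := by
  have h := meanAction_antitoneOn (N := N) (Set.mem_Ici.2 le_rfl) (Set.mem_Ici.2 hβ) hβ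
  dsimp only at h
  rw [meanAction_zero hN] at h
  exact h

/-- `⟨s⟩_β ≥ 0` (every real `β`). [folklore] -/
theorem meanAction_nonneg (β : ℝ) :
    0 ≤ (∫ V, (Matrix.trace (1 - (V : Matrix (Fin N) (Fin N) ℂ))).re * Real.exp (-(β * (Matrix.trace (1 - (V : Matrix (Fin N) (Fin N) ℂ))).re))
        ∂(haarProbability (Matrix.specialUnitaryGroup (Fin N) ℂ))) /
      ∫ V, Real.exp (-(β * (Matrix.trace (1 - (V : Matrix (Fin N) (Fin N) ℂ))).re)) ∂(haarProbability (Matrix.specialUnitaryGroup (Fin N) ℂ)) :=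
  div_nonneg (integral_nonneg fun V => mul_nonneg (re_trace_one_sub_nonneg V) (Real.exp_pos _).le) (plaquetteMass_SUN_pos_real β).le

end SUN

/-! ## §3 The free energy `F_N = −log Z_N` is `C¹`, concave and non-decreasing, with `F_N′ = ⟨s⟩_β` -/

section FreeEnergy

variable {N : ℕ}

/-- ABSTRACT: on a finite measure space with a measurable deficit `0 ≤ s ≤ M`, `β ↦ ∫ e^{−β·s} dμ` is differentiable at every real `β₀` with derivative
`−∫ s·e^{−β₀·s} dμ` (dominated differentiation under the integral: `|s·e^{−βs}| ≤ M·e^{M(|β₀|+1)}` for `|β − β₀| < 1`). [folklore] -/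
theorem hasDerivAt_integral_exp_neg_mul {X : Type*} [MeasurableSpace X] (μ : Measure X) [IsFiniteMeasure μ] {s : X → ℝ} (hsm : Measurable s)
    {M : ℝ} (hs0 : ∀ x, 0 ≤ s x) (hsM : ∀ x, s x ≤ M) (β₀ : ℝ) :
    HasDerivAt (fun β : ℝ => ∫ x, Real.exp (-(β * s x)) ∂μ) (-(∫ x, s x * Real.exp (-(β₀ * s x)) ∂μ)) β₀ := by
  -- a uniform bound for `e^{−βs}` when `|β − β₀| < 1`
  set K : ℝ := Real.exp (M * (|β₀| + 1)) with hK
  have hexpK : ∀ β : ℝ, |β - β₀| < 1 → ∀ x, Real.exp (-(β * s x)) ≤ K := fun β hβ x => by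
    have hβ' : |β| ≤ |β₀| + 1 := by have := abs_sub_abs_le_abs_sub β β₀; linarith
    have h1 : -(β * s x) ≤ |β| * s x := by
      have h := neg_abs_le β
      have := mul_le_mul_of_nonneg_right h (hs0 x)
      linarith
    have h2 : |β| * s x ≤ (|β₀| + 1) * M := mul_le_mul hβ' (hsM x) (hs0 x) (by positivity)
    rw [hK, Real.exp_le_exp]
    linarith
  have hball : ∀ β : ℝ, β ∈ ball β₀ 1 → |β - β₀| < 1 := fun β hβ => by
    rwa [mem_ball_iff_norm, Real.norm_eq_abs] at hβ
  have hF_meas : ∀ᶠ β in 𝓝 β₀, AEStronglyMeasurable (fun x => Real.exp (-(β * s x))) μ :=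
    Filter.Eventually.of_forall fun β => (Real.measurable_exp.comp ((hsm.const_mul β).neg)).aestronglyMeasurable
  have hF_int : Integrable (fun x => Real.exp (-(β₀ * s x))) μ :=
    Integrable.of_bound (Real.measurable_exp.comp ((hsm.const_mul β₀).neg)).aestronglyMeasurable K (ae_of_all _ fun x => by
      rw [Real.norm_eq_abs, abs_of_pos (Real.exp_pos _)]; exact hexpK β₀ (by simp) x)
  have hF'_meas : AEStronglyMeasurable (fun x => Real.exp (-(β₀ * s x)) * (-(s x))) μ :=
    ((Real.measurable_exp.comp ((hsm.const_mul β₀).neg)).mul hsm.neg).aestronglyMeasurable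
  have h_bound : ∀ᵐ x ∂μ, ∀ β ∈ ball β₀ 1, ‖Real.exp (-(β * s x)) * (-(s x))‖ ≤ K * M := ae_of_all _ fun x β hβ => by
    rw [Real.norm_eq_abs, abs_mul, abs_neg, abs_of_nonneg (hs0 x), abs_of_pos (Real.exp_pos _)]
    exact mul_le_mul (hexpK β (hball β hβ) x) (hsM x) (hs0 x) (le_trans (Real.exp_pos _).le (hexpK β (hball β hβ) x))
  have h_diff : ∀ᵐ x ∂μ, ∀ β ∈ ball β₀ 1, HasDerivAt (fun β : ℝ => Real.exp (-(β * s x))) (Real.exp (-(β * s x)) * (-(s x))) β :=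
    ae_of_all _ fun x β _ => by
      have h1 : HasDerivAt (fun b : ℝ => -(b * s x)) (-(s x)) β := by
        have h := (hasDerivAt_id' β).mul_const (-(s x))
        rw [one_mul] at h
        have e : (fun b : ℝ => b * -s x) = fun b => -(b * s x) := by funext b; ring
        rwa [e] at h
      exact h1.exp
  have h := (hasDerivAt_integral_of_dominated_loc_of_deriv_le (ball_mem_nhds β₀ one_pos) hF_meas hF_int hF'_meas h_bound (integrable_const _) h_diff).2
  have hrew : ∫ x, Real.exp (-(β₀ * s x)) * (-(s x)) ∂μ = -(∫ x, s x * Real.exp (-(β₀ * s x)) ∂μ) := by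
    rw [← integral_neg]; congr 1; funext x; ring
  rw [hrew] at h
  exact h

/-- **DIFFERENTIATION UNDER THE HAAR INTEGRAL, EVERY `N` AND EVERY REAL `β`**:
`d∕dβ ∫ e^{−β·Re tr(1−V)} dHaar_{SU(N)}(V) = −∫ Re tr(1−V)·e^{−β·Re tr(1−V)} dHaar_{SU(N)}(V)` (the abstract lemma with `0 ≤ Re tr(1−V) ≤ 2N`). [folklore] -/
theorem hasDerivAt_plaquetteMass_SUN (β₀ : ℝ) :
    HasDerivAt (fun β : ℝ => ∫ V, Real.exp (-(β * (Matrix.trace (1 - (V : Matrix (Fin N) (Fin N) ℂ))).re)) ∂(haarProbability (Matrix.specialUnitaryGroup (Fin N) ℂ)))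
      (-(∫ V, (Matrix.trace (1 - (V : Matrix (Fin N) (Fin N) ℂ))).re * Real.exp (-(β₀ * (Matrix.trace (1 - (V : Matrix (Fin N) (Fin N) ℂ))).re))
        ∂(haarProbability (Matrix.specialUnitaryGroup (Fin N) ℂ)))) β₀ :=
  hasDerivAt_integral_exp_neg_mul (haarProbability (Matrix.specialUnitaryGroup (Fin N) ℂ)) measurable_re_trace_one_sub
    re_trace_one_sub_nonneg re_trace_one_sub_le_two_mul β₀

/-- **THE FREE ENERGY's DERIVATIVE IS THE TILTED MEAN ACTION**: at every real `β`, `d∕dβ (−log Z_N(β)) = ⟨s⟩_β = ∫ s e^{−βs} ∕ ∫ e^{−βs}`. [folklore] -/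
theorem hasDerivAt_freeEnergy_SUN (β : ℝ) :
    HasDerivAt (fun β : ℝ => -Real.log (∫ V, Real.exp (-(β * (Matrix.trace (1 - (V : Matrix (Fin N) (Fin N) ℂ))).re)) ∂(haarProbability (Matrix.specialUnitaryGroup (Fin N) ℂ))))
      ((∫ V, (Matrix.trace (1 - (V : Matrix (Fin N) (Fin N) ℂ))).re * Real.exp (-(β * (Matrix.trace (1 - (V : Matrix (Fin N) (Fin N) ℂ))).re))
          ∂(haarProbability (Matrix.specialUnitaryGroup (Fin N) ℂ))) /
        ∫ V, Real.exp (-(β * (Matrix.trace (1 - (V : Matrix (Fin N) (Fin N) ℂ))).re)) ∂(haarProbability (Matrix.specialUnitaryGroup (Fin N) ℂ))) β := by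
  have hZ := plaquetteMass_SUN_pos_real (N := N) β
  have h0 := (hasDerivAt_plaquetteMass_SUN (N := N) β).log hZ.ne'
  have h := h0.const_mul (-1 : ℝ)
  have ef : (fun b : ℝ => (-1 : ℝ) * Real.log (∫ V, Real.exp (-(b * (Matrix.trace (1 - (V : Matrix (Fin N) (Fin N) ℂ))).re))
      ∂(haarProbability (Matrix.specialUnitaryGroup (Fin N) ℂ)))) = fun b : ℝ => -Real.log (∫ V, Real.exp (-(b * (Matrix.trace (1 - (V : Matrix (Fin N) (Fin N) ℂ))).re))
      ∂(haarProbability (Matrix.specialUnitaryGroup (Fin N) ℂ))) := by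
    funext b; ring
  rw [ef] at h
  refine h.congr_deriv ?_
  ring

/-- **THE FREE ENERGY IS CONCAVE ON `[0, ∞)`, EVERY `N`** (`F′ = ⟨s⟩` is antitone there). [folklore] -/
theorem freeEnergy_SUN_concaveOn :
    ConcaveOn ℝ (Set.Ici (0 : ℝ)) (fun β : ℝ =>
      -Real.log (∫ V, Real.exp (-(β * (Matrix.trace (1 - (V : Matrix (Fin N) (Fin N) ℂ))).re)) ∂(haarProbability (Matrix.specialUnitaryGroup (Fin N) ℂ)))) := by
  have hderiv := fun β : ℝ => hasDerivAt_freeEnergy_SUN (N := N) β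
  refine AntitoneOn.concaveOn_of_deriv (convex_Ici 0) ?_ ?_ ?_
  · exact fun β _ => (hderiv β).continuousAt.continuousWithinAt
  · exact fun β _ => (hderiv β).differentiableAt.differentiableWithinAt
  · rw [interior_Ici]
    intro β₁ h₁ β₂ h₂ h₁₂
    rw [(hderiv β₁).deriv, (hderiv β₂).deriv]
    exact meanAction_antitoneOn (N := N) (Set.mem_Ici.2 (le_of_lt h₁)) (Set.mem_Ici.2 (le_of_lt h₂)) h₁₂

/-- **THE FREE ENERGY IS NON-DECREASING ON `[0, ∞)`, EVERY `N`** (`F′ = ⟨s⟩ ≥ 0`). [folklore] -/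
theorem freeEnergy_SUN_monotoneOn :
    MonotoneOn (fun β : ℝ =>
      -Real.log (∫ V, Real.exp (-(β * (Matrix.trace (1 - (V : Matrix (Fin N) (Fin N) ℂ))).re)) ∂(haarProbability (Matrix.specialUnitaryGroup (Fin N) ℂ))))
      (Set.Ici (0 : ℝ)) := by
  have hderiv := fun β : ℝ => hasDerivAt_freeEnergy_SUN (N := N) β
  refine monotoneOn_of_deriv_nonneg (convex_Ici 0) ?_ ?_ ?_
  · exact fun β _ => (hderiv β).continuousAt.continuousWithinAt
  · exact fun β _ => (hderiv β).differentiableAt.differentiableWithinAt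
  · intro β _
    rw [(hderiv β).deriv]
    exact meanAction_nonneg β

/-- **`Z_N` IS LOG-CONVEX IN THE COUPLING ON `[0, ∞)`, EVERY `N`**: `β ↦ log ∫ e^{−β·Re tr(1−V)} dHaar_{SU(N)}(V)` is convex. [folklore] -/
theorem log_plaquetteMass_SUN_convexOn :
    ConvexOn ℝ (Set.Ici (0 : ℝ)) (fun β : ℝ =>
      Real.log (∫ V, Real.exp (-(β * (Matrix.trace (1 - (V : Matrix (Fin N) (Fin N) ℂ))).re)) ∂(haarProbability (Matrix.specialUnitaryGroup (Fin N) ℂ)))) := by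
  have h2 := neg_convexOn_iff.2 (freeEnergy_SUN_concaveOn (N := N))
  have e : (-fun β : ℝ => -Real.log (∫ V, Real.exp (-(β * (Matrix.trace (1 - (V : Matrix (Fin N) (Fin N) ℂ))).re)) ∂(haarProbability (Matrix.specialUnitaryGroup (Fin N) ℂ))))
      = fun β : ℝ => Real.log (∫ V, Real.exp (-(β * (Matrix.trace (1 - (V : Matrix (Fin N) (Fin N) ℂ))).re)) ∂(haarProbability (Matrix.specialUnitaryGroup (Fin N) ℂ))) := by
    funext β; simp only [Pi.neg_apply, neg_neg]
  rw [e] at h2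
  exact h2

/-- **THE FREE ENERGY IS AT MOST `Nβ`** (`N ≥ 2`, every real `β`): `−log Z_N(β) ≤ N·β` — V46's tangent floor `Z_N(β) ≥ e^{−Nβ}` in free-energy form (quoted by
name; consistent with `F(0) = 0`, `F′ = ⟨s⟩ ≤ N`). [folklore] -/
theorem freeEnergy_SUN_le (hN : 2 ≤ N) (β : ℝ) :
    -Real.log (∫ V, Real.exp (-(β * (Matrix.trace (1 - (V : Matrix (Fin N) (Fin N) ℂ))).re)) ∂(haarProbability (Matrix.specialUnitaryGroup (Fin N) ℂ))) ≤ N * β := by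
  have hfloor := CompactFibrePlaquetteMassSUNTangentFloor.exp_neg_mul_le_plaquetteMass_SUN hN β
  have hlog := Real.log_le_log (Real.exp_pos _) hfloor
  rw [Real.log_exp] at hlog
  linarith

end FreeEnergy

end Summit.QuantumFields.BalabanUV.T4Continuum.NE7b.CompactFibreMeanActionSUNMonotone

end
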